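import Summits.HodgeConjecture.HodgeConjecture.Theorems.NikulinTwinTransportLefschetzOneOneK3Assembly
import Literature.NumberTheory.Transcendental.DeRhamTheoremCechProofs
import Literature.NumberTheory.Transcendental.DeRhamTheoremProofs
import Literature.AlgebraicGeometry.HodgeTheory.ComplexifiedDeRhamFamily
import Literature.AlgebraicGeometry.HodgeTheory.HodgeFiltration
import Literature.Geometry.Kaehler.HolomorphicLineBundle
import Literature.Geometry.Kaehler.ManifoldFormsChart
import Literature.Geometry.Kaehler.LocalForms
import Literature.AlgebraicGeometry.HodgeTheory.LefschetzOneOneCechIntegrality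

/-!
# Route NikulinTwinTransport — `LefschetzOneOneK3`, `∂∂̄`–exponential line: the residual input (Z), named

The explicit hypothesis `hZ` of `NikulinTwinTransportLefschetzOneOneK3Assembly.lean` — integral
classes have integral Čech cocycles on a finite chart-convex cover, in degree `2`, for de Rham's
integration comparison — is a published comparison theorem (Čech–de Rham–singular over `ℤ ⊆ ℂ`
on an acyclic cover, compatible with integration: Bott–Tu Thm. 8.9, Prop. 9.5, Thm. 15.8; Weil
1952 §§3–4). It is NAMED here as a `Prop` so that it can be cited, tracked and discharged, and the
three consequences of the assembly are restated against the name: the Chern–Weil heart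
`∃ e₀, e₀.IsNatural ∧ e₀.IsLefschetzOneOne`, the route item `LefschetzOneOneK3` (with the
Kodaira–Serre sections), and the named fact `lefschetzOneOne_rational` (with the
meromorphic-section lemma of Voisin I, Cor. 11.34).
-/

noncomputable section

open scoped Manifold ContDiff Topology
open Set
open Literature.Geometry.Kaehler
open Literature.NumberTheory.Transcendental
open Literature.AlgebraicGeometry
open Literature.AlgebraicGeometry.HodgeTheory
open Literature.AlgebraicTopology.SingularHomology (singularCohomology)

namespace Summit.HodgeConjecture.HodgeConjecture.Theorems

/-! ### The residual topological input (Z) -/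

/-- **The printed heart `∃ e₀, e₀.IsNatural ∧ e₀.IsLefschetzOneOne` from `CechCocycleIntegral`.**
[cite: VoisinHodgeI2002, Thm. 11.30 and Thm. 7.10 (i)] -/
theorem deRhamLefschetzOneOne_of_cechCocycleIntegral (hZ : Literature.AlgebraicGeometry.HodgeTheory.CechCocycleIntegral) (E : Type)
    [NormedAddCommGroup E] [NormedSpace ℂ E] [FiniteDimensional ℂ E] :
    ∃ e₀ : ComplexDeRhamIsoFamily E, e₀.IsNatural ∧ e₀.IsLefschetzOneOne :=
  deRhamLefschetzOneOne_of_cechIntegral hZ E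

/-- **`LefschetzOneOneK3` from `CechCocycleIntegral` and the Kodaira–Serre sections on Hodge models
of the item's surfaces.** [cite: VoisinHodgeI2002, Thm. 11.30, Thm. 7.10 (i) and Cor. 11.34] -/
theorem lefschetzOneOneK3_of_cechCocycleIntegral_of_globalSections (hZ : Literature.AlgebraicGeometry.HodgeTheory.CechCocycleIntegral)
    (h₂ : ∀ ⦃S : Motives.SchemeOver ℂ⦄,
      (Motives.IsSmoothProjective 2 S ∧ Subsingleton (Motives.structureSheafCohomology S.left 1) ∧
        ∃ (A : HodgeModel 2 S) (η : MForm 𝓘(ℝ, A.model) A.carrier ℂ 2),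
          Literature.Geometry.Kaehler.IsHolomorphicInCharts η ∧ ∀ x, η x ≠ 0) →
      ∀ (A : HodgeModel 2 S) (ι : Type) (L : HolomorphicLineBundle ι A.model A.carrier),
        ∃ (κ : Type) (L' : HolomorphicLineBundle κ A.model A.carrier)
          (σ₁ : (L.tensor L').GlobalSection) (σ₂ : L'.GlobalSection),
          σ₁.zeroSet ≠ Set.univ ∧ σ₂.zeroSet ≠ Set.univ) :
    Summit.HodgeConjecture.HodgeConjecture.Theses.NikulinTwinTransport.LefschetzOneOneK3 :=
  lefschetzOneOneK3_of_cechIntegral_of_globalSections hZ h₂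

/-- **The named fact `lefschetzOneOne_rational` from `CechCocycleIntegral` and the meromorphic-section
lemma of Cor. 11.34.** [cite: VoisinHodgeI2002, Thm. 11.30, Cor. 11.34 and §11.3.3] -/
theorem lefschetzOneOne_rational_of_cechCocycleIntegral_of_isTrivialOn (hZ : Literature.AlgebraicGeometry.HodgeTheory.CechCocycleIntegral)
    (h₂ : ∀ ⦃n : ℕ⦄ ⦃X : Motives.SchemeOver ℂ⦄, Motives.IsSmoothProjective n X →
      ∀ (A : HodgeModel n X) (ι : Type) (L : HolomorphicLineBundle ι A.model A.carrier),
      ∃ S : Set A.carrier, Literature.Geometry.Kaehler.IsAnalyticSet 𝓘(ℂ, A.model) S ∧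
        S ≠ Set.univ ∧ L.IsTrivialOn Sᶜ) :
    lefschetzOneOne_rational :=
  lefschetzOneOne_rational_of_cechIntegral_of_isTrivialOn hZ h₂

end Summit.HodgeConjecture.HodgeConjecture.Theorems

end
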